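import Summits.QuantumFields.YangMills.Theorems.BalabanLadderUVSeamRecCeilingsBlockFieldLocality
import Summits.QuantumFields.YangMills.Theorems.BalabanLadderUVSeamRecCeilingsDLRPeelingColourClasses
import Summits.QuantumFields.YangMills.Theorems.BalabanLadderUVSeamRecCeilingsPolymerRarityLevelwise
import HarnessLib

/-!
# Crux `UVSeamRec` (stmt-QuantumFields-20043), lane B: DLR peeling of EXPONENTIAL WEIGHTS — from the one-box uniform conditional rarity
# bound (UCR_k) to the exponential moments of a weighted large-field count on a window family, with NO root of the weight

Helper file (`--supports stmt-QuantumFields-20043`) of the width-lever seat `ym-20043-ceilings-p2` (lane B, gen 8); sequel of g6/g7's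
`…CeilingsDLRPeeling` (the peeling engine `torusE_prod_le_prod_of_kerE_le`), `…CeilingsDLRPeelingWindowCellLaw` (thinning into
`K = 256(2m+4)⁴` window-disjoint colour classes) and `…CeilingsBlockFieldLocality` (true support `b^k y + [0,4b^k)⁴` of the events).

THE POINT.  g6/g7 compose (UCR_k) — `kerE^η_{collar cube}(1_{E_γ}) ≤ w` for every exterior `η` — with the (RM) architecture through a
PRODUCT LAW on indicators: only one colour class in `K` can be peeled at a time, so Hölder over the classes turns `w` into the activity
`w^{1/K}` (and g3's sign classes into `w^{1/(16K)}`), whence the summability clause `Σ_k w_k^{1/(16K)} ≤ D` of the v8/v8b candidates —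
astronomically lossy (g7 note §4).  The root is an artefact of peeling INDICATORS.  Peel the EXPONENTIAL WEIGHTS instead: for `t ≥ 0` the
function `exp(t(1_E − 1)) = e^{−t} + (1 − e^{−t})1_E` is a `[0,1]`-valued cylinder observable with the support of `1_E`, its cube-kernel mean is
`≤ e^{−t} + (1 − e^{−t})w` for every exterior (linearity of the kernel), so the engine gives, on one window-disjoint colour class `C`,
`⟨∏_{γ∈C} exp(t_γ 1_{E_γ})⟩ ≤ ∏_{γ∈C} (1 + (e^{t_γ} − 1)w)`; Hölder over the `K` classes (g3's `integral_exp_sum_le_exp_sum_of_holder`, all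
exponents `K`) then costs a factor `K` INSIDE the exponential weight, not a root of `w`:
* (prequel `…CeilingsDLRPeelingColourClasses`: `exists_windowColouring` — g6's colouring with ALL classes; every colour class of a window family is
  window-disjoint with a common torus window.)
* `torusE_prod_expWeight_le_of_uniformKernelBound` — the peeling of exponential weights on one colour class.
* `torusE_exp_sum_indicator_le_of_uniformKernelBound` — for a window family `A` of level-`k` block-plaquettes, collar `m ≥ 3`, torus holding the
  collar cube, coefficients `t_γ ≥ 0`:  `⟨exp(Σ_{γ∈A} t_γ 1_{E_γ}∘lift)⟩_{2L+1,β} ≤ exp((1/K)·Σ_{γ∈A} (e^{K t_γ} − 1)·w)`, `K = 256(2m+4)⁴`.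
  For `K t_γ ≤ 1` the right-hand side is `≤ exp((e−1)·w·Σ_γ t_γ)` — LINEAR in `w`.  The sequel `…CeilingsDLRPeelingLinearBudget` feeds this to a
  level assembly with geometric Hölder exponents and obtains the (RM) large-field half with the PLAIN summability `Σ_k w_k ≤ D`.
HONEST FRAMING.  Folklore probability (DLR + Hölder); (UCR_k) is the OPEN one-box large-field input (Bałaban's R-operation currency with
Dirichlet data, classically consistent only above the flat-penetration value of the collar cube); nothing of E0′; not a gap, not Clay.
References: folklore; T. Bałaban, Commun. Math. Phys. 122 (1989) 355–392 (intended supplier of (UCR_k)).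
-/

set_option autoImplicit false

noncomputable section

open MeasureTheory Filter Topology Finset
open Literature.MathematicalPhysics.QuantumFieldTheory (GaugeConfig wilsonMeasure LatticeRep isProbabilityMeasure_wilsonMeasure
  measurable_torusLift)
open Literature.MathematicalPhysics.QuantumLattice (LGConfig torusLift IsCylinder ymSpecification isProbabilityMeasure_ymSpecification
  integrable_of_abs_le)

namespace Summit.QuantumFields.YangMills.Cruxes.UVSeamRec.DLRPeeling

open Summit.QuantumFields.YangMills.Cruxes.OSLegsFromFemtoAndGap.DlrCollarTransfer
open Summit.QuantumFields.YangMills.Cruxes.UVSeamRec.PolymerData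
open Summit.QuantumFields.YangMills.Cruxes.UVSeamRec.BlockFieldLocality

/-! ## §1 Peeling exponential weights on one window-disjoint class -/

section ExpWeights

variable {N : ℕ} [NeZero N] (r : LatticeRep (Matrix.specialUnitaryGroup (Fin N) ℂ))

/-- The normalised exponential weight of an indicator: for `t ≥ 0` and `χ ∈ {0,1}`, `exp(t(χ − 1)) = e^{−t} + (1 − e^{−t})χ`. [folklore] -/
theorem exp_mul_indicator_sub_one_eq {Ω : Type*} (E : Set Ω) (t : ℝ) (ω : Ω) :
    Real.exp (t * (E.indicator (fun _ => (1 : ℝ)) ω - 1)) =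
      Real.exp (-t) + (1 - Real.exp (-t)) * E.indicator (fun _ => (1 : ℝ)) ω := by
  classical
  by_cases h : ω ∈ E
  · simp [Set.indicator_of_mem h]
  · simp [Set.indicator_of_notMem h]

omit [NeZero N] in
/-- **Cube-kernel bound of the normalised exponential weight.**  If `kerE^η(1_E) ≤ w` and `t ≥ 0` then
`kerE^η(exp(t(1_E − 1))) ≤ e^{−t} + (1 − e^{−t})·w` (linearity of the kernel, `1 − e^{−t} ≥ 0`). [folklore] -/
theorem kerE_expWeight_le (β : ℝ) (c : Fin 4 → ℤ) (b : ℕ) (η : LGConfig 4 (Matrix.specialUnitaryGroup (Fin N) ℂ))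
    {E : Set (LGConfig 4 (Matrix.specialUnitaryGroup (Fin N) ℂ))} (hE : MeasurableSet E) {t w : ℝ} (ht : 0 ≤ t)
    (hw : kerE (Matrix.specialUnitaryGroup (Fin N) ℂ) r β c b η (E.indicator fun _ => (1 : ℝ)) ≤ w) :
    kerE (Matrix.specialUnitaryGroup (Fin N) ℂ) r β c b η
        (fun U => Real.exp (t * (E.indicator (fun _ => (1 : ℝ)) U - 1))) ≤
      Real.exp (-t) + (1 - Real.exp (-t)) * w := by
  haveI := r.secondCountableTopology
  haveI := isProbabilityMeasure_ymSpecification r.ρ r.continuous β (cubeEdges c b) η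
  have hχm : Measurable fun U : LGConfig 4 (Matrix.specialUnitaryGroup (Fin N) ℂ) => E.indicator (fun _ => (1 : ℝ)) U :=
    measurable_const.indicator hE
  have hχint : Integrable (fun U => E.indicator (fun _ => (1 : ℝ)) U) (ymSpecification (d := 4) r.ρ β (cubeEdges c b) η) := by
    refine integrable_of_abs_le hχm (C := 1) fun U => ?_
    rw [abs_of_nonneg (Set.indicator_nonneg (fun _ _ => zero_le_one) _)]
    exact Set.indicator_apply_le' (fun _ => le_rfl) (fun _ => zero_le_one)
  have h1t : 0 ≤ 1 - Real.exp (-t) := by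
    have : Real.exp (-t) ≤ 1 := by rw [Real.exp_le_one_iff]; linarith
    linarith
  unfold kerE at hw ⊢
  have hfun : (fun U => Real.exp (t * (E.indicator (fun _ => (1 : ℝ)) U - 1))) =
      fun U => Real.exp (-t) + (1 - Real.exp (-t)) * E.indicator (fun _ => (1 : ℝ)) U := by
    funext U; exact exp_mul_indicator_sub_one_eq E t U
  rw [hfun, integral_add (integrable_const _) (hχint.const_mul _), integral_const, smul_eq_mul, probReal_univ, one_mul,
    integral_const_mul]
  exact add_le_add le_rfl (mul_le_mul_of_nonneg_left hw h1t)

/-- **PEELING EXPONENTIAL WEIGHTS ON ONE WINDOW-DISJOINT CLASS.**  `SU(N)`, any lattice representation, any `β`; block size `𝔟`, collar `m ≥ 3`,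
threshold `ε`, level `k`; a weight `w` with (UCR_k): `kerE^η_{(b^k(y−m),(2m+1)b^k)}(1_{largeFieldEvent 𝔟 ε (k,y,μ,ν)}) ≤ w` for all `y, μ<ν, η`.
For a finite family `C` of level-`k` block-plaquettes whose collar cubes sit in one engine window `lo + [1, 2L−1−side]` and are pairwise
window-disjoint, and coefficients `t_γ ≥ 0`:
`⟨∏_{γ∈C} exp(t_γ(1_{E_γ}∘lift − 1))⟩_{2L+1,β} ≤ ∏_{γ∈C} (e^{−t_γ} + (1 − e^{−t_γ})w)` — the engine `torusE_prod_le_prod_of_kerE_le` on the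
`[0,1]`-valued cylinder observables `exp(t_γ(1_{E_γ} − 1))` (true supports `b^k y + [0,4b^k)⁴`, `localBox_window`). [folklore] -/
theorem torusE_prod_expWeight_le_of_uniformKernelBound (β : ℝ) (𝔟 : BlockSize) (m : ℕ) (hm : 3 ≤ m) (ε : ℝ) (k L : ℕ)
    (w : ℝ) (hw0 : 0 ≤ w)
    (hUCR : ∀ (y : Fin 4 → ℤ) (μ ν : Fin 4) (h : μ < ν) (η : LGConfig 4 (Matrix.specialUnitaryGroup (Fin N) ℂ)),
      kerE (Matrix.specialUnitaryGroup (Fin N) ℂ) r β (fun i => (𝔟.b : ℤ) ^ k * (y i - m)) ((2 * m + 1) * 𝔟.b ^ k) η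
        ((largeFieldEvent (N := N) 𝔟 ε ⟨k, y, μ, ν, h⟩).indicator fun _ => (1 : ℝ)) ≤ w)
    (C : Finset Polymer) (hC : ∀ γ ∈ C, γ.k = k) (lo : Fin 4 → ℤ)
    (hlo : ∀ γ ∈ C, ∀ j, lo j + 1 ≤ (𝔟.b : ℤ) ^ k * (γ.y j - m) ∧
      (𝔟.b : ℤ) ^ k * (γ.y j - m) + (((2 * m + 1) * 𝔟.b ^ k : ℕ) : ℤ) + 2 ≤ lo j + (2 * L + 1 : ℕ))
    (hdisj : ∀ γ ∈ C, ∀ γ' ∈ C, γ ≠ γ' → ∃ j,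
      (𝔟.b : ℤ) ^ k * (γ.y j - m) + (((2 * m + 1) * 𝔟.b ^ k : ℕ) : ℤ) + 1 ≤ (𝔟.b : ℤ) ^ k * (γ'.y j - m) ∨
      (𝔟.b : ℤ) ^ k * (γ'.y j - m) + (((2 * m + 1) * 𝔟.b ^ k : ℕ) : ℤ) + 1 ≤ (𝔟.b : ℤ) ^ k * (γ.y j - m))
    (t : Polymer → ℝ) (ht : ∀ γ ∈ C, 0 ≤ t γ) :
    torusE (Matrix.specialUnitaryGroup (Fin N) ℂ) r β L (fun U => ∏ γ ∈ C,
        Real.exp (t γ * ((largeFieldEvent (N := N) 𝔟 ε γ).indicator (fun _ => (1 : ℝ)) U - 1))) ≤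
      ∏ γ ∈ C, (Real.exp (-t γ) + (1 - Real.exp (-t γ)) * w) := by
  classical
  set E : Polymer → Set (LGConfig 4 (Matrix.specialUnitaryGroup (Fin N) ℂ)) := fun γ => largeFieldEvent (N := N) 𝔟 ε γ with hEdef
  have hχ01 : ∀ γ (U : LGConfig 4 (Matrix.specialUnitaryGroup (Fin N) ℂ)),
      0 ≤ (E γ).indicator (fun _ => (1 : ℝ)) U ∧ (E γ).indicator (fun _ => (1 : ℝ)) U ≤ 1 := fun γ U =>
    ⟨Set.indicator_nonneg (fun _ _ => zero_le_one) _, Set.indicator_apply_le' (fun _ => le_rfl) (fun _ => zero_le_one)⟩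
  refine torusE_prod_le_prod_of_kerE_le (Matrix.specialUnitaryGroup (Fin N) ℂ) r β L lo C
    (fun γ i => (𝔟.b : ℤ) ^ k * (γ.y i - m)) (fun _ => (2 * m + 1) * 𝔟.b ^ k) hlo hdisj
    (fun γ U => Real.exp (t γ * ((E γ).indicator (fun _ => (1 : ℝ)) U - 1)))
    (fun γ _ => ((measurable_const.indicator (measurableSet_largeFieldEvent (N := N) 𝔟 ε γ)).sub_const _ |>.const_mul _).exp)
    (fun γ hγ U => ⟨(Real.exp_pos _).le, ?_⟩)
    (fun γ => (Fintype.piFinset fun i => Finset.Ico ((𝔟.b : ℤ) ^ γ.k * γ.y i)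
      ((𝔟.b : ℤ) ^ γ.k * γ.y i + 4 * (𝔟.b : ℤ) ^ γ.k)) ×ˢ (Finset.univ : Finset (Fin 4)))
    (fun γ _ => ?_) (fun γ hγ e he j => ?_)
    (fun γ => Real.exp (-t γ) + (1 - Real.exp (-t γ)) * w) (fun γ hγ => ?_) (fun γ hγ η => ?_)
  · -- values in `[0,1]`
    rw [Real.exp_le_one_iff]
    exact mul_nonpos_of_nonneg_of_nonpos (ht γ hγ) (by linarith [(hχ01 γ U).2])
  · -- cylinder on the true support
    intro U V hUV
    have h := isCylinder_indicator_largeFieldEvent_local (N := N) 𝔟 ε γ hUV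
    simp only [hEdef] at h ⊢
    rw [h]
  · -- the support sits in the collar cube window
    have hk := hC γ hγ
    have h := localBox_window 𝔟 m hm γ.k γ.y he j
    rw [hk] at h
    exact h
  · -- nonnegative weights
    have h1 : 0 ≤ 1 - Real.exp (-t γ) := by
      have : Real.exp (-t γ) ≤ 1 := by rw [Real.exp_le_one_iff]; linarith [ht γ hγ]
      linarith
    positivity
  · -- the kernel bound, from (UCR_k) by linearity
    have hk := hC γ hγ
    have hU : kerE (Matrix.specialUnitaryGroup (Fin N) ℂ) r β (fun i => (𝔟.b : ℤ) ^ k * (γ.y i - m)) ((2 * m + 1) * 𝔟.b ^ k) η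
        ((E γ).indicator fun _ => (1 : ℝ)) ≤ w := by
      obtain ⟨kk, y, μ, ν, h⟩ := γ
      simp only at hk
      subst hk
      exact hUCR y μ ν h η
    exact kerE_expWeight_le r β _ _ η (measurableSet_largeFieldEvent (N := N) 𝔟 ε γ) (ht γ hγ) hU

/-- `e^{t}·(e^{−t} + (1 − e^{−t})w) = 1 + (e^{t} − 1)w`. [folklore] -/
theorem exp_mul_expWeightBound (t w : ℝ) :
    Real.exp t * (Real.exp (-t) + (1 - Real.exp (-t)) * w) = 1 + (Real.exp t - 1) * w := by
  have h : Real.exp t * Real.exp (-t) = 1 := by rw [← Real.exp_add, add_neg_cancel, Real.exp_zero]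
  calc Real.exp t * (Real.exp (-t) + (1 - Real.exp (-t)) * w)
      = Real.exp t * Real.exp (-t) + (Real.exp t - Real.exp t * Real.exp (-t)) * w := by ring
    _ = 1 + (Real.exp t - 1) * w := by rw [h]

/-- **EXPONENTIAL MOMENTS ON ONE WINDOW-DISJOINT CLASS**:  `⟨exp(Σ_{γ∈C} t_γ 1_{E_γ}∘lift)⟩ ≤ ∏_{γ∈C} (1 + (e^{t_γ} − 1)w) ≤ exp(Σ_{γ∈C}(e^{t_γ} − 1)w)`
(pull the constants `e^{t_γ}` out of `torusE_prod_expWeight_le_of_uniformKernelBound`). [folklore] -/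
theorem torusE_exp_sum_le_of_windowDisjoint (β : ℝ) (𝔟 : BlockSize) (m : ℕ) (hm : 3 ≤ m) (ε : ℝ) (k L : ℕ)
    (w : ℝ) (hw0 : 0 ≤ w)
    (hUCR : ∀ (y : Fin 4 → ℤ) (μ ν : Fin 4) (h : μ < ν) (η : LGConfig 4 (Matrix.specialUnitaryGroup (Fin N) ℂ)),
      kerE (Matrix.specialUnitaryGroup (Fin N) ℂ) r β (fun i => (𝔟.b : ℤ) ^ k * (y i - m)) ((2 * m + 1) * 𝔟.b ^ k) η
        ((largeFieldEvent (N := N) 𝔟 ε ⟨k, y, μ, ν, h⟩).indicator fun _ => (1 : ℝ)) ≤ w)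
    (C : Finset Polymer) (hC : ∀ γ ∈ C, γ.k = k) (lo : Fin 4 → ℤ)
    (hlo : ∀ γ ∈ C, ∀ j, lo j + 1 ≤ (𝔟.b : ℤ) ^ k * (γ.y j - m) ∧
      (𝔟.b : ℤ) ^ k * (γ.y j - m) + (((2 * m + 1) * 𝔟.b ^ k : ℕ) : ℤ) + 2 ≤ lo j + (2 * L + 1 : ℕ))
    (hdisj : ∀ γ ∈ C, ∀ γ' ∈ C, γ ≠ γ' → ∃ j,
      (𝔟.b : ℤ) ^ k * (γ.y j - m) + (((2 * m + 1) * 𝔟.b ^ k : ℕ) : ℤ) + 1 ≤ (𝔟.b : ℤ) ^ k * (γ'.y j - m) ∨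
      (𝔟.b : ℤ) ^ k * (γ'.y j - m) + (((2 * m + 1) * 𝔟.b ^ k : ℕ) : ℤ) + 1 ≤ (𝔟.b : ℤ) ^ k * (γ.y j - m))
    (t : Polymer → ℝ) (ht : ∀ γ ∈ C, 0 ≤ t γ) :
    torusE (Matrix.specialUnitaryGroup (Fin N) ℂ) r β L (fun U => Real.exp (∑ γ ∈ C,
        t γ * (largeFieldEvent (N := N) 𝔟 ε γ).indicator (fun _ => (1 : ℝ)) U)) ≤
      Real.exp (∑ γ ∈ C, (Real.exp (t γ) - 1) * w) := by
  classical
  have hpeel := torusE_prod_expWeight_le_of_uniformKernelBound r β 𝔟 m hm ε k L w hw0 hUCR C hC lo hlo hdisj t ht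
  -- `exp(Σ t χ) = (∏ e^{t}) · ∏ exp(t(χ − 1))`
  set P : ℝ := ∏ γ ∈ C, Real.exp (t γ) with hP
  have hP0 : 0 ≤ P := Finset.prod_nonneg fun γ _ => (Real.exp_pos _).le
  have hpt : ∀ U : LGConfig 4 (Matrix.specialUnitaryGroup (Fin N) ℂ),
      Real.exp (∑ γ ∈ C, t γ * (largeFieldEvent (N := N) 𝔟 ε γ).indicator (fun _ => (1 : ℝ)) U) =
        P * ∏ γ ∈ C, Real.exp (t γ * ((largeFieldEvent (N := N) 𝔟 ε γ).indicator (fun _ => (1 : ℝ)) U - 1)) := by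
    intro U
    rw [Real.exp_sum, hP, ← Finset.prod_mul_distrib]
    refine Finset.prod_congr rfl fun γ _ => ?_
    rw [← Real.exp_add]
    congr 1
    ring
  have hlhs : torusE (Matrix.specialUnitaryGroup (Fin N) ℂ) r β L (fun U => Real.exp (∑ γ ∈ C,
        t γ * (largeFieldEvent (N := N) 𝔟 ε γ).indicator (fun _ => (1 : ℝ)) U)) =
      P * torusE (Matrix.specialUnitaryGroup (Fin N) ℂ) r β L (fun U => ∏ γ ∈ C,
        Real.exp (t γ * ((largeFieldEvent (N := N) 𝔟 ε γ).indicator (fun _ => (1 : ℝ)) U - 1))) := by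
    unfold torusE
    rw [← integral_const_mul]
    exact integral_congr_ae (ae_of_all _ fun U => hpt _)
  rw [hlhs]
  calc P * torusE (Matrix.specialUnitaryGroup (Fin N) ℂ) r β L (fun U => ∏ γ ∈ C,
          Real.exp (t γ * ((largeFieldEvent (N := N) 𝔟 ε γ).indicator (fun _ => (1 : ℝ)) U - 1)))
      ≤ P * ∏ γ ∈ C, (Real.exp (-t γ) + (1 - Real.exp (-t γ)) * w) := mul_le_mul_of_nonneg_left hpeel hP0
    _ = ∏ γ ∈ C, (1 + (Real.exp (t γ) - 1) * w) := by
        rw [hP, ← Finset.prod_mul_distrib]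
        exact Finset.prod_congr rfl fun γ _ => exp_mul_expWeightBound (t γ) w
    _ ≤ ∏ γ ∈ C, Real.exp ((Real.exp (t γ) - 1) * w) := by
        refine Finset.prod_le_prod (fun γ hγ => ?_) fun γ hγ => ?_
        · have : 0 ≤ (Real.exp (t γ) - 1) * w :=
            mul_nonneg (by linarith [Real.one_le_exp (ht γ hγ)]) hw0
          linarith
        · have := Real.add_one_le_exp ((Real.exp (t γ) - 1) * w)
          linarith
    _ = Real.exp (∑ γ ∈ C, (Real.exp (t γ) - 1) * w) := by rw [Real.exp_sum]

end ExpWeights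

/-! ## §2 Hölder over the colour classes: the window-family bound with the factor `K` INSIDE the weight -/

section Window

variable {N : ℕ} [NeZero N] (r : LatticeRep (Matrix.specialUnitaryGroup (Fin N) ℂ))

/-- **EXPONENTIAL MOMENTS OF A WEIGHTED LARGE-FIELD COUNT ON A WINDOW FAMILY FROM (UCR_k) — NO ROOT OF THE WEIGHT.**  `SU(N)`, any lattice
representation, any `β`; ANY odd block size `𝔟`, collar `m ≥ 3`, threshold `ε`, level `k`, odd torus `2L+1` holding the collar cube
(`(2m+1)b^k + 3 ≤ 2L+1`); a weight `w ≥ 0` with (UCR_k) for all `y, μ<ν, η`.  For every window origin `o`, every finite family `A` of level-`k`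
block-plaquettes whose blocks fit in `[o, o+2L+1)⁴`, and coefficients `t_γ ≥ 0`:
`⟨exp(Σ_{γ∈A} t_γ·1_{largeFieldEvent 𝔟 ε γ}∘lift)⟩_{2L+1,β} ≤ exp((1/K)·Σ_{γ∈A} (e^{K·t_γ} − 1)·w)`,  `K = 256(2m+4)⁴`.
Proof: colour `A` by `exists_windowColouring` (every class window-disjoint with a common window), bound each class by
`torusE_exp_sum_le_of_windowDisjoint` with coefficients `K t_γ`, and combine the `K` classes by the generalised Hölder inequality with all
exponents `K` (g3's `PolymerRarity.integral_exp_sum_le_exp_sum_of_holder`).  HONEST FRAMING: reduction; (UCR_k) is the open input. [folklore] -/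
theorem torusE_exp_sum_indicator_le_of_uniformKernelBound (β : ℝ) (𝔟 : BlockSize) (m : ℕ) (hm : 3 ≤ m) (ε : ℝ) (k L : ℕ)
    (hfit : (2 * m + 1) * 𝔟.b ^ k + 3 ≤ 2 * L + 1) (w : ℝ) (hw0 : 0 ≤ w)
    (hUCR : ∀ (y : Fin 4 → ℤ) (μ ν : Fin 4) (h : μ < ν) (η : LGConfig 4 (Matrix.specialUnitaryGroup (Fin N) ℂ)),
      kerE (Matrix.specialUnitaryGroup (Fin N) ℂ) r β (fun i => (𝔟.b : ℤ) ^ k * (y i - m)) ((2 * m + 1) * 𝔟.b ^ k) η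
        ((largeFieldEvent (N := N) 𝔟 ε ⟨k, y, μ, ν, h⟩).indicator fun _ => (1 : ℝ)) ≤ w)
    (o : Fin 4 → ℤ) (A : Finset Polymer) (hA : ∀ γ ∈ A, γ.k = k)
    (hwin : ∀ γ ∈ A, ∀ c, o c ≤ anchor 𝔟 γ c ∧ anchor 𝔟 γ c + (𝔟.b : ℤ) ^ k ≤ o c + (2 * L + 1))
    (t : Polymer → ℝ) (ht : ∀ γ ∈ A, 0 ≤ t γ) :
    torusE (Matrix.specialUnitaryGroup (Fin N) ℂ) r β L (fun U => Real.exp (∑ γ ∈ A,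
        t γ * (largeFieldEvent (N := N) 𝔟 ε γ).indicator (fun _ => (1 : ℝ)) U)) ≤
      Real.exp ((1 : ℝ) / (256 * (2 * m + 4) ^ 4) * ∑ γ ∈ A, (Real.exp (256 * (2 * m + 4) ^ 4 * t γ) - 1) * w) := by
  classical
  haveI : NeZero (2 * m + 4) := ⟨by omega⟩
  haveI := isProbabilityMeasure_wilsonMeasure (d := 4) (L := 2 * L + 1) r.ρ r.continuous β
  set K : ℝ := 256 * (2 * (m : ℝ) + 4) ^ 4 with hKdef
  have hK0 : 0 < K := by rw [hKdef]; positivity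
  have hKcard : (Fintype.card (Fin 4 × Fin 4 × (Fin 4 → Bool) × (Fin 4 → ZMod (2 * m + 4))) : ℝ) = K := by
    rw [card_windowColour m, hKdef]; push_cast; ring
  -- the colour classes
  obtain ⟨col, hcol⟩ := exists_windowColouring 𝔟 m k L hfit o A hA hwin
  let cls : Fin 4 × Fin 4 × (Fin 4 → Bool) × (Fin 4 → ZMod (2 * m + 4)) → Finset Polymer := fun c => A.filter fun γ => col γ = c
  let χ : Polymer → LGConfig 4 (Matrix.specialUnitaryGroup (Fin N) ℂ) → ℝ := fun γ U =>
    (largeFieldEvent (N := N) 𝔟 ε γ).indicator (fun _ => (1 : ℝ)) U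
  have hχ01 : ∀ γ (U : LGConfig 4 (Matrix.specialUnitaryGroup (Fin N) ℂ)), 0 ≤ χ γ U ∧ χ γ U ≤ 1 := fun γ U =>
    ⟨Set.indicator_nonneg (fun _ _ => zero_le_one) _, Set.indicator_apply_le' (fun _ => le_rfl) (fun _ => zero_le_one)⟩
  have hχm : ∀ γ, Measurable (χ γ) := fun γ => measurable_const.indicator (measurableSet_largeFieldEvent (N := N) 𝔟 ε γ)
  -- per class: the peeling bound with coefficients `K t`
  have hclass : ∀ c, ∫ U, Real.exp (K * ∑ γ ∈ cls c, t γ * χ γ (torusLift (2 * L + 1) U))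
      ∂(wilsonMeasure (d := 4) (L := 2 * L + 1) r.ρ β) ≤ Real.exp (K * ((1 / K) * ∑ γ ∈ cls c, (Real.exp (K * t γ) - 1) * w)) := by
    intro c
    have hcA : cls c ⊆ A := Finset.filter_subset _ _
    obtain ⟨lo, hlo, hdisj⟩ := hcol c
    have h := torusE_exp_sum_le_of_windowDisjoint r β 𝔟 m hm ε k L w hw0 hUCR (cls c) (fun γ hγ => hA γ (hcA hγ)) lo hlo hdisj
      (fun γ => K * t γ) (fun γ hγ => mul_nonneg hK0.le (ht γ (hcA hγ)))
    rw [← mul_assoc, mul_one_div_cancel hK0.ne', one_mul]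
    refine (le_of_eq ?_).trans h
    unfold torusE
    refine integral_congr_ae (ae_of_all _ fun U => ?_)
    simp only [χ, Finset.mul_sum]
    refine congrArg Real.exp (Finset.sum_congr rfl fun γ _ => by ring)
  -- Hölder over the colours, all exponents `K`
  have key := PolymerRarity.integral_exp_sum_le_exp_sum_of_holder (wilsonMeasure (d := 4) (L := 2 * L + 1) r.ρ β)
    (Finset.univ : Finset (Fin 4 × Fin 4 × (Fin 4 → Bool) × (Fin 4 → ZMod (2 * m + 4))))
    (fun c U => ∑ γ ∈ cls c, t γ * χ γ (torusLift (2 * L + 1) U))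
    (fun c _ => Finset.measurable_sum _ fun γ _ => ((hχm γ).comp (measurable_torusLift _)).const_mul _)
    (fun c => ∑ γ ∈ cls c, t γ)
    (fun c _ U => by
      have hcA : cls c ⊆ A := Finset.filter_subset _ _
      rw [abs_of_nonneg (Finset.sum_nonneg fun γ hγ => mul_nonneg (ht γ (hcA hγ)) (hχ01 γ _).1)]
      exact Finset.sum_le_sum fun γ hγ => by
        simpa using mul_le_mul_of_nonneg_left (hχ01 γ (torusLift (2 * L + 1) U)).2 (ht γ (hcA hγ)))
    (fun _ => K) (fun c => (1 / K) * ∑ γ ∈ cls c, (Real.exp (K * t γ) - 1) * w) (fun _ _ => hK0)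
    (by rw [Finset.sum_const, Finset.card_univ, nsmul_eq_mul, hKcard, mul_one_div_cancel hK0.ne'])
    (fun c _ => hclass c)
  -- reassemble the sums over the classes
  have hsumF : ∀ U : GaugeConfig 4 (2 * L + 1) (Matrix.specialUnitaryGroup (Fin N) ℂ),
      ∑ c, ∑ γ ∈ cls c, t γ * χ γ (torusLift (2 * L + 1) U) = ∑ γ ∈ A, t γ * χ γ (torusLift (2 * L + 1) U) := fun U =>
    Finset.sum_fiberwise A col fun γ => t γ * χ γ (torusLift (2 * L + 1) U)
  have hsumC : ∑ c, (1 / K) * ∑ γ ∈ cls c, (Real.exp (K * t γ) - 1) * w =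
      (1 / K) * ∑ γ ∈ A, (Real.exp (K * t γ) - 1) * w := by
    rw [← Finset.mul_sum, Finset.sum_fiberwise A col fun γ => (Real.exp (K * t γ) - 1) * w]
  unfold torusE
  simp only [hsumF] at key
  rw [hsumC] at key
  simpa only [hKdef] using key

end Window

end Summit.QuantumFields.YangMills.Cruxes.UVSeamRec.DLRPeeling

end
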